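import Summits.BirchSwinnertonDyer.BirchSwinnertonDyer.Theorems.EisensteinPrimesMazurMCOnCellBTwistbackOrderOneRankOne
import Literature.NumberTheory.EllipticCurves.GlobalMinimalModelProofs
import HarnessLib

/-!
# Crux 3 `MazurMCOnCellB` (stmt-BirchSwinnertonDyer-19033), line `twistback` v4 — road (c′), the DOOR: stub 6
# (∃-PARTNER) at a non-split X2b pair from ONE admissible `K` whose twist carries the `L`-function certificate
# `ord_{T=0} L_p(E^{(d_K)}, T) = 1` — no analytic-rank input

Width seat bsd-line-x2-p1-w5 (g0), 2026-08-28; sequel of `…TwistbackOrderOneRankOne` (p650915). HONEST FRAMING (cell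
`bsd-eis`, run/shared/lean/pub/bsd-eis/): conditional theorem only. Named facts BY NAME: the route's `PublishedInputs`
(stmt-…-19037), Disegni 2020 Thm. 4(1) (`padicBSD_rankOne_nonsplitMult`, PUB), Dokchitser–Dokchitser 2010 Thm. 1.4
(`selmerCorank_mod_two_eq`, PUB), Keller–Yin 2024 Thm. E multiplicative half (`thmE_pConverse_semistable_OPEN`, UNREFEREED
PREPRINT resting on Castella arXiv:2409.01360 — the theorem below is conditional on that OPEN claim; the line already
carries Keller–Yin Thm. D, PRE). No `def`, no `sorry`; no main conjecture / BSD proved for any curve unconditionally;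
0 cells / labels / stubs / tiers move.

WHAT. LEAD g9's road (c) (p640749): at a NON-split partner the single analytic certificate `ord_{T=0} L_p = 1` for THE
non-split Mazur–Tate–Teitelbaum function gives the partner's upper half (§3(i)
`missingUpperBoundAt_of_cellC_of_not_split_of_gvPar_of_orderOne`, which asks for `X2.CellC`, i.e. `r_an = 1`, and
`GVPar`). Here the (W, p)-instance of stub 6 is assembled from ONE admissible `K` such that every minimal model of
`E^{(d_K)}` carries that certificate — the partner's analytic rank is DERIVED (p650915 §1: Kato 18.4 via Wuthrich Thm. 16
+ `p`-parity + Keller–Yin Thm. E) and `GVPar` of the twist is the parity flip of `¬ GVPar W`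
(`gvPar_of_not_gvPar_of_twist`). Serves EVERY non-split X2b row (any local balance): what is left per pair is the
certificate, class-wide the horizontal non-vanishing of `L_p′(E^K, 0)` (open in print).

References: [Disegni2020] Thm. 4; [SteinWuthrich2013] Thm. 6.1; [GreenbergVatsal2000] Thm. (1.3), Thm. (3.11);
[Wuthrich2014] Thm. 16; [Kato2004Asterisque] Thm. 18.4; [DokchitserDokchitserAnnals2010] Thm. 1.4; [KellerYin2024] Thm. E
(PRE); [SilvermanAEC2009] VIII.8 Cor. 8.3.
-/

set_option autoImplicit false

-- `Summit.BirchSwinnertonDyer.BirchSwinnertonDyer.…`: the summit and its single sub-problem share a name.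
set_option linter.dupNamespace false

noncomputable section

open scoped Classical MatrixGroups ModularForm

open CongruenceSubgroup WeierstrassCurve NumberField IsDedekindDomain Field
  Literature.NumberTheory.EllipticCurves
  Literature.NumberTheory.GaloisRepresentations
  Literature.NumberTheory.EllipticCurves.ModularForms
  Literature.NumberTheory.QuadraticFields
  Literature.NumberTheory.EllipticCurves.Rank1Residual
  Literature.NumberTheory.EllipticCurves.Rank1Residual.Typed
  Literature.NumberTheory.EllipticCurves.Disegni2020
  Literature.NumberTheory.EllipticCurves.KellerYin2024
  Summit.BirchSwinnertonDyer.Rank1Residual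
  Summit.BirchSwinnertonDyer.Rank1Residual.X2
  Summit.BirchSwinnertonDyer.BirchSwinnertonDyer.Theses
  Summit.BirchSwinnertonDyer.BirchSwinnertonDyer.Theorems.EisensteinPrimesMazurMCOnCellBTwistbackOnePartnerCertificates
  Summit.BirchSwinnertonDyer.BirchSwinnertonDyer.Theorems.EisensteinPrimesMazurMCOnCellBTwistbackLamOneRankOne
  Summit.BirchSwinnertonDyer.BirchSwinnertonDyer.Theorems.EisensteinPrimesMazurMCOnCellBTwistbackOrderOneRankOne

namespace Summit.BirchSwinnertonDyer.BirchSwinnertonDyer.Theorems.EisensteinPrimesMazurMCOnCellBTwistbackOrderOnePartner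

/-- **Stub 6's conclusion AT ONE non-split X2b pair (VERBATIM shape) from the `L`-function certificate of ONE partner,
the partner's analytic rank DERIVED.** For a NON-split X2b pair `(W, p)` (`ord_{s=1} L(E, s) = 0`, `p ≠ 2` non-split
multiplicative, `E[p]` reducible, `¬ GVPar`) and ONE admissible `K` (imaginary quadratic, Heegner for `N_W` and for `p`,
`d_K` odd `< −4`) such that every globally minimal model `Wd` of `E^{(d_K)}` has `ord_{T=0} L = 1` for THE non-split
Mazur–Tate–Teitelbaum function of every newform/`ϖ` of `Wd` (`hordL`, the p640749 certificate): the partner clause of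
`stub_upperPartner` holds at `(W, p)` with this `K`. The twist is X2 (`X2.classX2_twist`), NON-split at `p` (`p` splits
in `K`), `GVPar` (`gvPar_of_not_gvPar_of_twist`, parity flip), of odd analytic rank (`r_an(E) = 0`, Heegner sign;
p649897 §2), so p650915 §1 gives `r_an(Wd) = 1` (read on a minimal model, `hasGlobalMinimalModel_rat_holds`), and
p640749 §3(i) gives the upper half at every minimal model. Inputs BY NAME: `PublishedInputs`, Disegni Thm. 4(1),
Dokchitser (PUB); Keller–Yin Thm. E (PRE); per partner `hordL`. [claim: KellerYin2024, status: under-review]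
[cite: Disegni2020, Thm. 4 (§3.2)] [cite: SteinWuthrich2013, Thm. 6.1 (p. 20), §4.2] [cite: GreenbergVatsal2000, Thm. (1.3) with pp. 14–15]
[cite: Wuthrich2014, Thm. 16 (p. 397)] [cite: DokchitserDokchitserAnnals2010, Thm. 1.4] [cite: SilvermanAEC2009, VIII.8 Cor. 8.3] -/
theorem upperPartner_at_of_orderOne_partner_of_thmE (hP : EisensteinPrimes.PublishedInputs)
    (hDis : padicBSD_rankOne_nonsplitMult)
    (hDD : ∀ (V : WeierstrassCurve ℚ) [V.IsElliptic] (ℓ : ℕ) [Fact ℓ.Prime], selmerCorank_mod_two_eq V ℓ)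
    (hKY : thmE_pConverse_semistable_OPEN)
    (W : WeierstrassCurve ℚ) [W.IsElliptic] [W.IsGloballyMinimal] (p : ℕ) [Fact p.Prime]
    (hc : X2.CellB W p) (hns : ¬ W.HasSplitMultiplicativeReductionAtPrime p)
    (K : Type) [Field K] [NumberField K] (hK : IsImaginaryQuadratic K)
    (hHN : SatisfiesHeegnerHypothesis (W.conductorNorm ℤ) K) (hHp : SatisfiesHeegnerHypothesis p K)
    (hodd : Odd (NumberField.discr K)) (hlt : NumberField.discr K < -4)
    (hordL : ∀ (Wd : WeierstrassCurve ℚ) [Wd.IsElliptic] [Wd.IsGloballyMinimal],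
      (∃ C : VariableChange ℚ, C • Wd = W.quadraticTwist (NumberField.discr K : ℚ)) →
      ∀ {M : ℕ} [NeZero M] (f : CuspForm (Gamma0 M) 2), IsNewformOf Wd f →
      ∀ (ϖ : ℚ), (ϖ : ℝ) * Wd.realPeriodRat = plusPeriod f →
      ∀ L : PowerSeries ℚ_[p], IsMultPAdicLFunctionOf f p (-1) L → L.order = ((1 : ℕ) : ℕ∞)) :
    ∃ (K : Type) (_ : Field K) (_ : NumberField K), IsImaginaryQuadratic K ∧
      SatisfiesHeegnerHypothesis (W.conductorNorm ℤ) K ∧ SatisfiesHeegnerHypothesis p K ∧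
      Odd (NumberField.discr K) ∧ NumberField.discr K < -4 ∧
      (W.quadraticTwist (NumberField.discr K : ℚ)).analyticRank = 1 ∧
      ∀ (Wd : WeierstrassCurve ℚ) [Wd.IsElliptic] [Wd.IsGloballyMinimal],
        (∃ C : VariableChange ℚ, C • Wd = W.quadraticTwist (NumberField.discr K : ℚ)) →
        MissingUpperBoundAt Wd p := by
  have hpar := hP.2.2.2.2.1
  have hnf := hP.2.2.2.2.2.1
  have hWu := hP.2.2.2.2.2.2.2.2.2.2.2.2.2.2.1
  have hpP : p.Prime := Fact.out
  have hp2 : p ≠ 2 := hc.2.1.1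
  have hred : ¬ W.HasIrreducibleModPGaloisRep p := hc.2.1.2.1
  have hmult : W.HasMultiplicativeReductionAtPrime p := hc.2.1.2.2
  have hr0 : W.analyticRank = 0 := hc.1
  have hdK : (NumberField.discr K : ℚ) ≠ 0 := by exact_mod_cast NumberField.discr_ne_zero K
  haveI := W.isElliptic_quadraticTwist hdK
  have hneg : NumberField.discr K < 0 := IsImaginaryQuadratic.discr_neg hK
  have hpd : ¬ (p : ℤ) ∣ NumberField.discr K := not_dvd_discr_of_split hK hpP hp2 hHp
  -- every minimal model of the twist: X2, non-split, GVPar, odd analytic rank, hence `r_an = 1` and the upper half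
  have hmodel : ∀ (Wd : WeierstrassCurve ℚ) [Wd.IsElliptic] [Wd.IsGloballyMinimal],
      (∃ C : VariableChange ℚ, C • Wd = W.quadraticTwist (NumberField.discr K : ℚ)) →
      Wd.analyticRank = (W.quadraticTwist (NumberField.discr K : ℚ)).analyticRank ∧ Wd.analyticRank = 1 ∧
        MissingUpperBoundAt Wd p := by
    intro Wd _ _ hWd
    obtain ⟨C, hC⟩ := hWd
    have hXd : ClassX2 Wd p := X2.classX2_twist W p hc.2.1 K hK hHp Wd ⟨C, hC⟩
    have hgv : GVPar Wd p :=
      gvPar_of_not_gvPar_of_twist (W := W) (p := p) hp2 hred hc.2.2 hneg hpd Wd C (by simpa using hC)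
    have hnsd : ¬ Wd.HasSplitMultiplicativeReductionAtPrime p := fun hs ↦
      hns ((X2.hasSplitMultiplicativeReductionAtPrime_iff_of_smul_eq_quadraticTwist W Wd hK p hp2 hmult hHp
        hC).mp hs)
    have hrd : Wd.analyticRank = (W.quadraticTwist (NumberField.discr K : ℚ)).analyticRank := by
      have h := congrArg WeierstrassCurve.analyticRank hC
      rwa [analyticRank_smul] at h
    have hoddd : Odd Wd.analyticRank := by
      rw [hrd]
      exact EisensteinPrimesMazurMCOnCellBTwistbackLamOneRankOne.odd_analyticRank_quadraticTwist_of_analyticRank_eq_zero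
        hnf W hr0 K hK hHN
    have h1 : Wd.analyticRank = 1 :=
      EisensteinPrimesMazurMCOnCellBTwistbackOrderOneRankOne.analyticRank_eq_one_of_orderOne_of_odd hWu hpar hKY Wd p
        (hDD Wd p) hp2 hXd.2.2 hnsd hXd.2.1 hoddd (hordL Wd ⟨C, hC⟩)
    exact ⟨hrd, h1, EisensteinPrimesMazurMCOnCellBTwistbackOnePartnerCertificates.missingUpperBoundAt_of_cellC_of_not_split_of_gvPar_of_orderOne
      hP hDis Wd p ⟨h1, hXd⟩ hnsd hgv (hordL Wd ⟨C, hC⟩)⟩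
  -- the twist has analytic rank `1` (read on any minimal model)
  obtain ⟨C₀, hC₀⟩ := hasGlobalMinimalModel_rat_holds (W.quadraticTwist (NumberField.discr K : ℚ))
  have hr1 : (W.quadraticTwist (NumberField.discr K : ℚ)).analyticRank = 1 := by
    haveI : (C₀ • W.quadraticTwist (NumberField.discr K : ℚ)).IsGloballyMinimal := hC₀
    obtain ⟨hrd, h1, -⟩ := hmodel (C₀ • W.quadraticTwist (NumberField.discr K : ℚ)) ⟨C₀⁻¹, inv_smul_smul C₀ _⟩
    rw [← hrd, h1]
  exact ⟨K, inferInstance, inferInstance, hK, hHN, hHp, hodd, hlt, hr1, fun Wd _ _ hWd ↦ (hmodel Wd hWd).2.2⟩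

end Summit.BirchSwinnertonDyer.BirchSwinnertonDyer.Theorems.EisensteinPrimesMazurMCOnCellBTwistbackOrderOnePartner

end
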